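import Mathlib.Analysis.SpecialFunctions.Pow.Real
import Mathlib.Tactic.FieldSimp
import Mathlib.Tactic.Linarith
import Mathlib.Tactic.Positivity
import Mathlib.Tactic.Ring
import HarnessLib

/-!
# The Frank–Wolfe recurrence with an inexact oracle and per-step perturbations

Topic `Analysis/Convexity`. The scalar heart of the `O(1/k)` convergence rate of the Frank–Wolfe
(conditional gradient) method with step size `αₖ = 2/(k+2)`: if the primal errors `hₖ` satisfy
`hₖ₊₁ ≤ (1 - αₖ) hₖ + αₖ ε + αₖ² C + ρ` — exact curvature term `αₖ² C` (Jaggi 2011, Lemma 4: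
`f(x⁽ᵏ⁺¹⁾) ≤ f(x⁽ᵏ⁾) - α g(x⁽ᵏ⁾) + α² C_f`), an additive inexactness `ε` of the linear
minimisation oracle (Jaggi 2011, §3, "approximate variant", after Hazan 2008) and an extra
perturbation `ρ ≥ 0` of each iterate (rounding) — then
`hₖ ≤ 4C/(k+2) + ε + k ρ` for all `k ≥ 1` (`frankWolfe_recurrence`; Jaggi 2011, Thm. 3:
`h(x⁽ᵏ⁾) ≤ 4C_f/(k+2)` in the exact case). PROVED by the printed induction. The first step uses
`α₀ = 1`, so no bound on `h₀` is needed.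

This is the form consumed by the finite-precision Frank–Wolfe scheme for the Lovász number
(`Literature/Combinatorics/SimpleGraph/LovaszThetaFrankWolfe*.lean`).

## References

* M. Jaggi, *Convex optimization without projection steps*, arXiv:1108.1170 (2011), §3, Lemma 4
  and Thm. 3 (held, `lit read arxiv:1108.1170`, chunk p0007) [Jaggi2011].
* E. Hazan, *Sparse approximate solutions to semidefinite programs*, LATIN 2008, LNCS 4957,
  306–316 [Hazan2008].
* M. Frank, P. Wolfe, *An algorithm for quadratic programming*, Naval Res. Logist. Quart. 3
  (1956) 95–110.
-/

namespace Literature.Analysis.Convexity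

/-- The algebraic step of the induction: `4C(t+1)/(t+2)² ≤ 4C/(t+3)` for `C ≥ 0`, `t ≥ 0`
(i.e. `(t+1)(t+3) ≤ (t+2)²`). [folklore] -/
theorem frankWolfe_step_ineq {C t : ℝ} (hC : 0 ≤ C) (ht : 0 ≤ t) :
    4 * C * (t + 1) / (t + 2) ^ 2 ≤ 4 * C / (t + 3) := by
  rw [div_le_div_iff₀ (by positivity) (by positivity)]
  nlinarith

/-- **The Frank–Wolfe recurrence** (Jaggi 2011, Thm. 3 and its proof, with the approximate
oracle of §3 and an additional per-step perturbation `ρ`): if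
`hₜ₊₁ ≤ (1 - 2/(t+2)) hₜ + (2/(t+2)) ε + (2/(t+2))² C + ρ` for all `t`, with `C, ρ ≥ 0`, then
`hₜ ≤ 4C/(t+2) + ε + t ρ` for all `t ≥ 1`. [cite: Jaggi2011, Thm. 3 and Lemma 4 (chunk p0007)] -/
theorem frankWolfe_recurrence (h : ℕ → ℝ) {C ε ρ : ℝ} (hC : 0 ≤ C) (hρ : 0 ≤ ρ)
    (hstep : ∀ t : ℕ, h (t + 1) ≤ (1 - 2 / ((t : ℝ) + 2)) * h t + 2 / ((t : ℝ) + 2) * ε +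
      (2 / ((t : ℝ) + 2)) ^ 2 * C + ρ) :
    ∀ t : ℕ, 1 ≤ t → h t ≤ 4 * C / ((t : ℝ) + 2) + ε + t * ρ := by
  intro t ht
  induction t, ht using Nat.le_induction with
  | base =>
    have h1 := hstep 0
    norm_num at h1
    norm_num
    linarith
  | succ t ht ih =>
    have hs := hstep t
    have ht0 : (0 : ℝ) ≤ t := Nat.cast_nonneg t
    have hcoef : 0 ≤ 1 - 2 / ((t : ℝ) + 2) := by
      rw [sub_nonneg, div_le_one (by positivity)]; linarith
    -- multiply the induction hypothesis by the nonnegative coefficient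
    have h2 : (1 - 2 / ((t : ℝ) + 2)) * h t ≤
        (1 - 2 / ((t : ℝ) + 2)) * (4 * C / ((t : ℝ) + 2) + ε + t * ρ) :=
      mul_le_mul_of_nonneg_left ih hcoef
    have key : (1 - 2 / ((t : ℝ) + 2)) * (4 * C / ((t : ℝ) + 2) + ε + t * ρ) +
        2 / ((t : ℝ) + 2) * ε + (2 / ((t : ℝ) + 2)) ^ 2 * C + ρ =
        4 * C * (t + 1) / ((t : ℝ) + 2) ^ 2 + ε + (t ^ 2 / ((t : ℝ) + 2) + 1) * ρ := by
      field_simp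
      ring
    have h3 : (t : ℝ) ^ 2 / ((t : ℝ) + 2) + 1 ≤ t + 1 := by
      rw [div_add_one (by positivity), div_le_iff₀ (by positivity)]; nlinarith
    have h4 := frankWolfe_step_ineq hC ht0
    push_cast
    calc h (t + 1) ≤ 4 * C * (t + 1) / ((t : ℝ) + 2) ^ 2 + ε + (t ^ 2 / ((t : ℝ) + 2) + 1) * ρ := by
          linarith [hs, h2, key]
      _ ≤ 4 * C / ((t : ℝ) + 3) + ε + (t + 1) * ρ := by
          have := mul_le_mul_of_nonneg_right h3 hρ
          linarith
      _ = 4 * C / ((t : ℝ) + 1 + 2) + ε + ((t : ℝ) + 1) * ρ := by ring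

end Literature.Analysis.Convexity
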